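import Mathlib
import Summits.CriticalPhenomena.CardyFormulaZ2.Theorems.CardySelfRefinementDefs
import Literature.Probability.LatticeModels.MeshColumns
import Literature.Probability.Percolation.QuadCrossingRotationInvariance
import Literature.Probability.LatticeModels.GridDomainHittingProbabilityProofs
import HarnessLib

/-!
# Boundary-layer surgery, topology brick (S4), part III: exits, near-exits, edge normals

Helper file of the registered stub `stub_layerLocalModification` (the deterministic
boundary-layer surgery) of the line `monotone-product-coordinates` (crux
`stmt-CriticalPhenomena-10269`, `…Theses.CardySelfRefinement.GradientComparability`).  Step (S4)
of the layer surgery (the cell-contact lemma, file `…StubLayerContact.lean`) follows, on either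
side of a no-room lattice edge `e`, the three other sides of the mesh cell beside `e` inset by
`ε`, up to the first exit from the open quad, and lets `ε → 0`.  This file contains:

* `exists_firstExit_of_isOpen` — the first exit time of a path from an open set;
* `near_firstExit_not_mem` (registered helper) — the limit step of the cell-contact lemma,
  without limits: if a walk `W` from a point of the closed set `F` leaves `F`, and no initial
  piece `W [0, t] ⊆ F` ends at a point of the closed set `G`, then no path uniformly close to `W`
  that stays in `F` before a time `τ` is in `G` at time `τ` (first exit time of `W` from `F`,
  a neighbourhood of the compact initial piece off `G`, continuity of `W` at the exit time);
* lattice bookkeeping: the two unit normals of a lattice edge (`rot_normal`), the open cells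
  beside an edge miss the grid lines (`edge_frame_not_mem_gridLines`), adjacent mesh points are
  at distance `δ`.

No percolation, no named fact.
-/

noncomputable section

namespace Summit.CriticalPhenomena.CardyFormulaZ2.Theorems.CardySelfRefinement

open scoped Topology
open Filter Set MeasureTheory
open Literature.Probability.LatticeModels Literature.Probability.Percolation
open Literature.Probability.Percolation.QuadCrossing
open Summit.CriticalPhenomena.CardyFormulaZ2.Theses.CardySelfRefinement

/-! ## First exit of a path from an open set -/

/-- **First exit.**  A path continuous on `[0, 1]`, starting in the open set `U` and outside
`U` at some time `t₁ ∈ [0, 1]`, has a first exit time `τ ∈ (0, t₁]`: `η τ ∉ U`,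
`η τ ∈ closure U`, and `η t ∈ U` for `t < τ`. -/
theorem exists_firstExit_of_isOpen {η : ℝ → ℂ} (hη : ContinuousOn η (Icc 0 1)) {U : Set ℂ}
    (hU : IsOpen U) (h0 : η 0 ∈ U) {t₁ : ℝ} (ht₁ : t₁ ∈ Icc (0 : ℝ) 1) (h1 : η t₁ ∉ U) :
    ∃ τ ∈ Ioc (0 : ℝ) t₁, η τ ∉ U ∧ η τ ∈ closure U ∧ ∀ t ∈ Ico (0 : ℝ) τ, η t ∈ U := by
  -- adapted from `exists_first_hit` (Literature/Topology/PlaneTopology/ArcGluing.lean)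
  set A : Set ℝ := {t | t ∈ Icc (0 : ℝ) 1 ∧ η t ∉ U} with hA
  have hAcl : IsClosed A := by
    have : A = Icc (0 : ℝ) 1 ∩ η ⁻¹' Uᶜ := by ext t; simp [hA]
    rw [this]
    exact hη.preimage_isClosed_of_isClosed isClosed_Icc hU.isClosed_compl
  have hAne : A.Nonempty := ⟨t₁, ht₁, h1⟩
  have hAbdd : BddBelow A := ⟨0, fun t ht => ht.1.1⟩
  set τ : ℝ := sInf A with hτ
  have hτA : τ ∈ A := hAcl.csInf_mem hAne hAbdd
  have hτpos : 0 < τ := by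
    rcases hτA.1.1.eq_or_lt with h | h
    · exact absurd (h ▸ h0) hτA.2
    · exact h
  have hbefore : ∀ t ∈ Ico (0 : ℝ) τ, η t ∈ U := by
    intro t ht
    by_contra h
    have : τ ≤ t := csInf_le hAbdd ⟨⟨ht.1, ht.2.le.trans hτA.1.2⟩, h⟩
    linarith [ht.2]
  have hsub : Ico (0 : ℝ) τ ⊆ Icc 0 1 := fun t ht => ⟨ht.1, ht.2.le.trans hτA.1.2⟩
  refine ⟨τ, ⟨hτpos, csInf_le hAbdd ⟨ht₁, h1⟩⟩, hτA.2, ?_, hbefore⟩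
  have hmem : η τ ∈ closure (η '' Ico 0 τ) := by
    refine ((hη τ hτA.1).mono hsub).mem_closure_image ?_
    rw [closure_Ico hτpos.ne]
    exact right_mem_Icc.2 hτpos.le
  refine closure_mono ?_ hmem
  rintro _ ⟨t, ht, rfl⟩
  exact hbefore t ht

/-! ## The limit step of the cell-contact lemma -/

/-- **No near first exit off the contact set** (brick (S4), part III, of the boundary-layer
surgery `stub_layerLocalModification`; registered helper).  Let `W` be a continuous walk with
`W 0` in the closed set `F`, leaving `F` at some time in `[0, 1]`, and assume that no initial piece
`W [0, t] ⊆ F` ends at a point `W t` of the closed set `G`.  Then there is `ε₂ > 0` such that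
every path `Λ` uniformly `ε₂`-close to `W` on `[0, 1]` that stays in `F` on `[0, τ)` is off `G`
at time `τ`. -/
theorem near_firstExit_not_mem : ∀ (W : ℝ → ℂ) (F G : Set ℂ), Continuous W → IsClosed F → IsClosed G → W 0 ∈ F → (∃ t ∈ Set.Icc (0 : ℝ) 1, W t ∉ F) → (∀ t ∈ Set.Icc (0 : ℝ) 1, W '' Set.Icc 0 t ⊆ F → W t ∉ G) → ∃ ε₂ : ℝ, 0 < ε₂ ∧ ∀ (Λ : ℝ → ℂ) (τ : ℝ), (∀ t ∈ Set.Icc (0 : ℝ) 1, dist (Λ t) (W t) < ε₂) → τ ∈ Set.Icc (0 : ℝ) 1 → Set.MapsTo Λ (Set.Ico 0 τ) F → Λ τ ∉ G := by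
  intro W F G hW hF hG h0 hout hno
  -- the exit time `T` of `W` from `F`
  set B : Set ℝ := {t | t ∈ Icc (0 : ℝ) 1 ∧ W t ∉ F} with hB
  obtain ⟨t₁, ht₁, ht₁F⟩ := hout
  have hBne : B.Nonempty := ⟨t₁, ht₁, ht₁F⟩
  have hBbdd : BddBelow B := ⟨0, fun t ht => ht.1.1⟩
  set T : ℝ := sInf B with hT
  have hT0 : 0 ≤ T := le_csInf hBne fun t ht => ht.1.1
  have hT1 : T ≤ 1 := (csInf_le hBbdd ⟨ht₁, ht₁F⟩).trans ht₁.2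
  have hbefore : ∀ t ∈ Ico (0 : ℝ) T, W t ∈ F := by
    intro t ht
    by_contra h
    have : T ≤ t := csInf_le hBbdd ⟨⟨ht.1, ht.2.le.trans hT1⟩, h⟩
    linarith [ht.2]
  have hWT : W T ∈ F := by
    rcases hT0.eq_or_lt with h | h
    · rw [← h]; exact h0
    · have key := closure_minimal (show Ico (0 : ℝ) T ⊆ W ⁻¹' F from hbefore) (hF.preimage hW)
      rw [closure_Ico h.ne] at key
      exact key (right_mem_Icc.2 h.le)
  have himg : W '' Icc 0 T ⊆ F := by
    rintro _ ⟨t, ht, rfl⟩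
    rcases ht.2.eq_or_lt with h | h
    · rw [h]; exact hWT
    · exact hbefore t ⟨ht.1, h⟩
  -- no contact on `W [0, T]`: a whole neighbourhood of it is off `G`
  have hK : IsCompact (W '' Icc 0 T) := isCompact_Icc.image hW
  have hKG : W '' Icc 0 T ⊆ Gᶜ := by
    rintro _ ⟨t, ht, rfl⟩
    exact hno t ⟨ht.1, ht.2.trans hT1⟩ ((image_mono (Icc_subset_Icc_right ht.2)).trans himg)
  obtain ⟨r₀, hr₀, hthick⟩ := hK.exists_thickening_subset_open hG.isOpen_compl hKG
  have hthick' : ∀ z w, w ∈ W '' Icc 0 T → dist z w < r₀ → z ∉ G := fun z w hw hzw =>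
    hthick (Metric.mem_thickening_iff.2 ⟨w, hw, hzw⟩)
  -- continuity of `W` at `T`, and an exit point of `W` just after `T`
  obtain ⟨η, hη, hηW⟩ := Metric.continuous_iff.1 hW T (r₀ / 2) (by positivity)
  obtain ⟨t', ht'B, ht'lt⟩ := exists_lt_of_csInf_lt hBne (show sInf B < T + η by linarith)
  have hTt' : T ≤ t' := csInf_le hBbdd ht'B
  obtain ⟨r', hr', hball⟩ := Metric.isOpen_iff.1 hF.isOpen_compl (W t') ht'B.2
  refine ⟨min (r₀ / 2) r', lt_min (by positivity) hr', fun Λ τ hΛ hτ hmaps hτG => ?_⟩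
  rcases le_or_gt τ T with hτT | hτT
  · -- exit before `T`: `Λ τ` is close to `W τ ∈ W [0, T]`
    refine hthick' (Λ τ) (W τ) ⟨τ, ⟨hτ.1, hτT⟩, rfl⟩ ?_ hτG
    exact (hΛ τ hτ).trans_le ((min_le_left _ _).trans (by linarith))
  rcases lt_or_ge t' τ with ht'τ | ht'τ
  · -- exit after `t'`: but `Λ t'` is close to `W t' ∉ F`
    exact hball ((hΛ t' ht'B.1).trans_le (min_le_right _ _)) (hmaps ⟨ht'B.1.1, ht'τ⟩)
  · -- `T < τ ≤ t' < T + η`: `Λ τ` is close to `W T`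
    have h1 : dist (W τ) (W T) < r₀ / 2 := by
      refine hηW τ ?_
      rw [Real.dist_eq, abs_of_pos (by linarith)]
      linarith
    refine hthick' (Λ τ) (W T) ⟨T, ⟨hT0, le_rfl⟩, rfl⟩ ?_ hτG
    calc dist (Λ τ) (W T) ≤ dist (Λ τ) (W τ) + dist (W τ) (W T) := dist_triangle _ _ _
      _ < r₀ / 2 + r₀ / 2 := add_lt_add ((hΛ τ hτ).trans_le (min_le_left _ _)) h1
      _ = r₀ := by ring

/-! ## Lattice bookkeeping: normals of an edge, open cells beside an edge -/

/-- A site plus a unit coordinate vector (given in coordinates) is a neighbour. -/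
theorem adj_add_of_unit {u n : Site 2}
    (h : (n 0 = 0 ∧ (n 1 = 1 ∨ n 1 = -1)) ∨ ((n 0 = 1 ∨ n 0 = -1) ∧ n 1 = 0)) :
    (zdGraph 2).Adj u (u + n) := by
  have hk : ∀ k : Fin 2, k = 0 ∨ k = 1 := by decide
  rw [zdGraph_adj_iff]
  rcases h with ⟨h0, h1 | h1⟩ | ⟨h0 | h0, h1⟩
  · exact ⟨1, Or.inl (funext fun k => by rcases hk k with rfl | rfl <;> simp [h0, h1])⟩
  · exact ⟨1, Or.inr (funext fun k => by rcases hk k with rfl | rfl <;> simp [h0, h1])⟩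
  · exact ⟨0, Or.inl (funext fun k => by rcases hk k with rfl | rfl <;> simp [h0, h1])⟩
  · exact ⟨0, Or.inr (funext fun k => by rcases hk k with rfl | rfl <;> simp [h0, h1])⟩

/-- **The two unit normals of a lattice edge.**  For a lattice edge `{u, u'}` and `σ = ±1`, the
vector `n = σ · rot (u' - u)` (rotation by a right angle) is a unit step with `u + n ∼ u`,
`u ± n ≠ u'`, and the mesh points of `u + n`, `u' + n` are `p + σ (p' - p) i`, `p' + σ (p' - p) i`
(`p = δu`, `p' = δu'`). -/
theorem rot_normal {u u' n : Site 2} (h : (zdGraph 2).Adj u u') {σ : ℤ} (hσ : σ = 1 ∨ σ = -1)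
    (hn : n = ![-(σ * (u' 1 - u 1)), σ * (u' 0 - u 0)]) :
    (zdGraph 2).Adj u (u + n) ∧ u + n ≠ u' ∧ u - n ≠ u' ∧
      (∀ δ : ℝ, meshPoint δ (u + n) =
        meshPoint δ u + (σ : ℂ) * ((meshPoint δ u' - meshPoint δ u) * Complex.I)) ∧
      ∀ δ : ℝ, meshPoint δ (u' + n) =
        meshPoint δ u' + (σ : ℂ) * ((meshPoint δ u' - meshPoint δ u) * Complex.I) := by
  have hk : ∀ k : Fin 2, k = 0 ∨ k = 1 := by decide
  have hn0 : n 0 = -(σ * (u' 1 - u 1)) := by rw [hn]; simp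
  have hn1 : n 1 = σ * (u' 0 - u 0) := by rw [hn]; simp
  have hσ2 : σ * σ = 1 := by rcases hσ with rfl | rfl <;> norm_num
  have hd := LSWGrid.sub_apply_of_adj h
  refine ⟨adj_add_of_unit ?_, fun heq => ?_, fun heq => ?_, fun δ => ?_, fun δ => ?_⟩
  · rcases hd with ⟨h0, h1⟩ | ⟨h0, h1⟩ | ⟨h0, h1⟩ | ⟨h0, h1⟩ <;> rcases hσ with rfl | rfl <;>
      simp [hn0, hn1, h0, h1]
  · have e0 := congrFun heq 0
    have e1 := congrFun heq 1
    simp only [Pi.add_apply, hn0, hn1] at e0 e1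
    apply h.ne
    funext k
    rcases hk k with rfl | rfl <;> rcases hσ with rfl | rfl <;> omega
  · have e0 := congrFun heq 0
    have e1 := congrFun heq 1
    simp only [Pi.sub_apply, hn0, hn1] at e0 e1
    apply h.ne
    funext k
    rcases hk k with rfl | rfl <;> rcases hσ with rfl | rfl <;> omega
  · apply Complex.ext
    · simp [hn0, Complex.mul_re, Complex.mul_im]; ring
    · simp [hn1, Complex.mul_re, Complex.mul_im]; ring
  · apply Complex.ext
    · simp [hn0, Complex.mul_re, Complex.mul_im]; ring
    · simp [hn1, Complex.mul_re, Complex.mul_im]; ring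

/-- A real strictly between `a - 1` and `a + 1` other than `a` is not an integer
(`a` an integer). -/
theorem intCast_add_ne_intCast (a k : ℤ) {x : ℝ} (h1 : -1 < x) (h2 : x < 1) (h0 : x ≠ 0) :
    (a : ℝ) + x ≠ k := by
  intro heq
  have h3 : ((k - a : ℤ) : ℝ) = x := by push_cast; linarith
  have h4 : -1 < ((k - a : ℤ) : ℝ) := h3 ▸ h1
  have h5 : ((k - a : ℤ) : ℝ) < 1 := h3 ▸ h2
  have h6 : (-1 : ℤ) < k - a := by exact_mod_cast h4
  have h7 : k - a < (1 : ℤ) := by exact_mod_cast h5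
  have h8 : k - a = 0 := by omega
  rw [h8] at h3
  exact h0 (by exact_mod_cast h3.symm)

/-- **The open cells beside a lattice edge miss the grid lines.**  For a lattice edge from
`p = δu` to `p' = δu'` (`δ > 0`) and real `s ∈ (0, 1)`, `r ∈ (-1, 1) ∖ {0}`, the point
`p + (p' - p)(s + r i)` lies on no grid line of `δℤ²` (hence on no drawn lattice edge). -/
theorem edge_frame_not_mem_gridLines {δ : ℝ} (hδ : 0 < δ) {u u' : Site 2}
    (h : (zdGraph 2).Adj u u') {s r : ℝ} (hs : s ∈ Ioo (0 : ℝ) 1) (hr1 : -1 < r) (hr2 : r < 1)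
    (hr0 : r ≠ 0) :
    meshPoint δ u + (meshPoint δ u' - meshPoint δ u) * ((s : ℂ) + (r : ℂ) * Complex.I) ∉
      Mesh.gridLines δ := by
  set z := meshPoint δ u + (meshPoint δ u' - meshPoint δ u) * ((s : ℂ) + (r : ℂ) * Complex.I)
    with hz
  have hre : z.re = δ * (u 0 + (((u' 0 - u 0 : ℤ) : ℝ) * s - ((u' 1 - u 1 : ℤ) : ℝ) * r)) := by
    simp only [hz, Complex.add_re, Complex.add_im, Complex.mul_re, Complex.sub_re, Complex.sub_im,
      meshPoint_re, meshPoint_im, Complex.ofReal_re, Complex.ofReal_im, Complex.mul_im,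
      Complex.I_re, Complex.I_im]
    push_cast; ring
  have him : z.im = δ * (u 1 + (((u' 1 - u 1 : ℤ) : ℝ) * s + ((u' 0 - u 0 : ℤ) : ℝ) * r)) := by
    simp only [hz, Complex.add_re, Complex.add_im, Complex.mul_re, Complex.sub_re, Complex.sub_im,
      meshPoint_re, meshPoint_im, Complex.ofReal_re, Complex.ofReal_im, Complex.mul_im,
      Complex.I_re, Complex.I_im]
    push_cast; ring
  have hs1 : -1 < s := by linarith [hs.1]
  have hs0 : s ≠ 0 := hs.1.ne'
  have hns1 : -1 < -s := by linarith [hs.2]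
  have hns2 : -s < 1 := by linarith [hs.1]
  have hns0 : -s ≠ 0 := neg_ne_zero.2 hs0
  have hnr1 : -1 < -r := by linarith
  have hnr2 : -r < 1 := by linarith
  have hnr0 : -r ≠ 0 := neg_ne_zero.2 hr0
  rintro (⟨k, hk⟩ | ⟨k, hk⟩)
  · rw [hre] at hk
    have hk' := mul_left_cancel₀ hδ.ne' hk
    rcases LSWGrid.sub_apply_of_adj h with ⟨h0, h1⟩ | ⟨h0, h1⟩ | ⟨h0, h1⟩ | ⟨h0, h1⟩ <;>
      simp only [h0, h1] at hk' <;> push_cast at hk'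
    · exact intCast_add_ne_intCast (u 0) k hs1 hs.2 hs0 (by linarith)
    · exact intCast_add_ne_intCast (u 0) k hns1 hns2 hns0 (by linarith)
    · exact intCast_add_ne_intCast (u 0) k hnr1 hnr2 hnr0 (by linarith)
    · exact intCast_add_ne_intCast (u 0) k hr1 hr2 hr0 (by linarith)
  · rw [him] at hk
    have hk' := mul_left_cancel₀ hδ.ne' hk
    rcases LSWGrid.sub_apply_of_adj h with ⟨h0, h1⟩ | ⟨h0, h1⟩ | ⟨h0, h1⟩ | ⟨h0, h1⟩ <;>
      simp only [h0, h1] at hk' <;> push_cast at hk'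
    · exact intCast_add_ne_intCast (u 1) k hr1 hr2 hr0 (by linarith)
    · exact intCast_add_ne_intCast (u 1) k hnr1 hnr2 hnr0 (by linarith)
    · exact intCast_add_ne_intCast (u 1) k hs1 hs.2 hs0 (by linarith)
    · exact intCast_add_ne_intCast (u 1) k hns1 hns2 hns0 (by linarith)

/-- The drawn lattice (all edges of `δℤ²`) lies on the grid lines. -/
theorem openEdgeUnion_univ_subset_gridLines (δ : ℝ) :
    openEdgeUnion δ (Set.univ : Set (Sym2 (Site 2))) ⊆ Mesh.gridLines δ := by
  intro z hz
  obtain ⟨x, y, hxy, -, hz⟩ := mem_openEdgeUnion_iff.1 hz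
  exact Mesh.segment_meshPoint_subset_gridLines δ hxy hz

/-- Adjacent mesh points are at distance `δ` (`δ > 0`). -/
theorem norm_meshPoint_sub_eq_of_adj {δ : ℝ} (hδ : 0 < δ) {u u' : Site 2}
    (h : (zdGraph 2).Adj u u') : ‖meshPoint δ u' - meshPoint δ u‖ = δ := by
  have hsq : ‖meshPoint δ u' - meshPoint δ u‖ ^ 2 = δ ^ 2 := by
    rw [Complex.sq_norm, Complex.normSq_apply, Complex.sub_re, Complex.sub_im, meshPoint_re,
      meshPoint_re, meshPoint_im, meshPoint_im]
    have e0 : ((u' 0 : ℤ) : ℝ) = u 0 + ((u' 0 - u 0 : ℤ) : ℝ) := by push_cast; ring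
    have e1 : ((u' 1 : ℤ) : ℝ) = u 1 + ((u' 1 - u 1 : ℤ) : ℝ) := by push_cast; ring
    rw [e0, e1]
    rcases LSWGrid.sub_apply_of_adj h with ⟨h0, h1⟩ | ⟨h0, h1⟩ | ⟨h0, h1⟩ | ⟨h0, h1⟩ <;>
      simp only [h0, h1] <;> push_cast <;> ring
  have h1 : 0 ≤ ‖meshPoint δ u' - meshPoint δ u‖ := norm_nonneg _
  nlinarith [sq_nonneg (‖meshPoint δ u' - meshPoint δ u‖ - δ),
    sq_nonneg (‖meshPoint δ u' - meshPoint δ u‖ + δ)]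

end Summit.CriticalPhenomena.CardyFormulaZ2.Theorems.CardySelfRefinement

end
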